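import Literature.Geometry.Kaehler.ComplexTorusPicardNumberOneEndomorphisms
import HarnessLib

/-!
# Infinitely many isogeny classes of abelian varieties of Picard number one, the additivity
# `{1, …, g} + R_h ⊆ R_{g+h}` (Hulek–Laface 2019, Props. 6.1, 6.3 — the case `F = ℚ`, explicit),
# and the ranges `R_4 = {1, …, 8, 10, 16}`, `R_5 = {1, …, 13, 15, 17, 25}`

Layer `Literature/Geometry/Kaehler`, namespace `Literature.Geometry.Kaehler.ComplexTorus`; lane
`lit-hodgefound`, Layer A4 (row A4-13).  Sequel of `ComplexTorusPicardNumberOne.lean` (the witnesses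
`ℂ^g/(iYℤ^g ⊕ ℤ^g)`, `Y = picardOneMatrix g N t = N·1 + (t^{e(a,b)})`, with `NS = ℤ·H` for `t`
transcendental) and `ComplexTorusPicardNumberOneEndomorphisms.lean` (`Hom_ℚ` in normal form; `End = ℤ`;
simplicity).  Here the INTEGER PARAMETER `N` is varied: for fixed `g` and `t` the witnesses
`X_N := ℂ^g/(iY_Nℤ^g ⊕ ℤ^g)`, `N > g`, are pairwise NON-ISOGENOUS.

Sources (held text `paper:arxiv-1703.05882`, verbatim):

* [HulekLaface2019PicardNumbersAV] §6.1 **Proposition 6.1.** "For any integers `g, h ≥ 0` we have an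
  inclusion `R_g + R_h := {x + y | x ∈ R_g, y ∈ R_h} ⊂ R_{g+h}`."  "Clearly, the idea is to use the
  additivity of Picard numbers for products of non-isogeneous abelian varieties, as proven in Corollary
  2.3. In order to be able to us[e] this we need that for any `k ∈ R_g` we find countably many abelian
  varieties of dimension `g` and Picard number `k` in different isogeny classes."  **Proposition 6.3.**
  "Given an integer `k ∈ R_g`, then there exist at least countably many isogeny classes of abelian
  varietiss of dimension `g` and Picard number `k`." (proof, last case: "the general situation where
  `F = End_ℚ(X) ≅ ℚ`. The ppav of this type are given by removing from `𝒜_g` a countable union of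
  proper Shimura varieties. Since `𝒜_g` has positive dimension and since the set of ppav isogeneous to a
  given abelian variety is countable, the claim follows.")
* [Lange2023AbelianVarietiesComplex] §3.1.5 Exercise (6)(a) (the equation `ZD⁻¹(cZ + dD) = aZ + bD` of
  an endomorphism in the period matrix), §2.4.4 Thm. 2.4.25 / Cor. 2.4.26 (Poincaré decomposition,
  `Hom` between powers of simple tori), §3.1 Prop. 3.1.1.

## What is proved (theorems only; NO definition, NO named fact, net debt 0)

Prop. 6.3's proof is a moduli count; Prop. 6.1 follows from it.  Formalised here is the case `k = 1`
of Prop. 6.3 by EXPLICIT witnesses, and the resulting part of Prop. 6.1 — the summands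
`x ∈ {1, …, g} ⊆ R_g` (those supplied by the witnesses; `{1, …, g} ⊆ R_g` is
`Icc_one_subset_picardNumbers`), for EVERY `y ∈ R_h`:

* §F1 coefficient extraction with TWO constants `N, N'` (the products `𝒴_{N'}𝒞𝒴_N` and the identity
  `𝒟𝒴_N = 𝒴_{N'}𝒜` in `M_g(ℤ[X])`): `𝒜 = 𝒴_{N'}𝒞𝒴_N ⇒ 𝒞 = 0`
  (`eq_zero_of_map_C_eq_picardOnePolyMatrix_mul_mul₂`); `𝒟𝒴_N = 𝒴_{N'}𝒜 ⇒ 𝒟 = ᵗ𝒜`, `𝒜` scalar,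
  `N𝒟 = N'𝒜` (`transpose_eq_and_scalar_of_map_C_mul_picardOnePolyMatrix_eq₂`), hence `𝒜 = 0 = 𝒟`
  when `N ≠ N'` (`eq_zero_of_map_C_mul_picardOnePolyMatrix_eq_of_ne`); transfers along `X ↦ t`.
* §F2 **`homRat_periodIsoOfNormalForm_picardOneMatrix_eq_bot_of_ne`: `Hom_ℚ(X_N, X_{N'}) = 0` for
  `N ≠ N'`** (an integer `(a b; c d) ∈ Hom` has `c = −Y_{N'}bY_N` and `dY_N = Y_{N'}a`, §E2 of the
  predecessor), hence **`not_isIsogenous_periodIsoOfNormalForm_picardOneMatrix_of_ne`**.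
* §F3 for every `N > g` (and `0 ≤ t ≤ 1` transcendental): `X_N` is an abelian variety
  (`isAbelianVariety_periodIsoOfNormalForm_picardOneMatrix`, Prop. 3.1.1), simple
  (`isSimple_periodIsoOfNormalForm_picardOneMatrix`), of Picard number one; **Prop. 6.3 for `k = 1`,
  explicit**: `exists_seq_pairwise_not_isIsogenous_picardNumber_one` — in every dimension `g ≥ 1` a
  sequence of pairwise non-isogenous simple abelian varieties with `End = ℤ` and `ρ = 1`.
* §F4 **`IsAbelianVariety.exists_homRat_picardOneMatrix_eq_bot`**: for every abelian variety `B` and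
  `g ≥ 1` some witness `X_N` of dimension `g` has `Hom_ℚ(X_N, B) = 0` (pigeonhole over the simple factors
  of `B`, as for the CM curves `E_{i√p}` of `ComplexTorusPicardNumberThirdGap.lean`); hence
  **`one_add_mem_picardNumbers : y ∈ R_h ⇒ 1 + y ∈ R_{g+h}`** (`g ≥ 1`, Cor. 2.3),
  `add_mem_picardNumbers : y ∈ R_h ⇒ j + y ∈ R_{j+h}`, **`add_mem_picardNumbers_of_le :
  y ∈ R_h, 1 ≤ k ≤ g ⇒ k + y ∈ R_{g+h}`** (Prop. 6.1 for the summands `{1, …, g}`),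
  `image_succ_picardNumbers_subset : R_h + 1 ⊆ R_{h+1}` (Prop. 6.1 with `g = 1` in full, `R_1 = {1}`),
  and the instance **`subset_picardNumbers_four : {2, …, 7, 10} ⊆ R_4`** (`= R_3 + 1`).
* §F5 **`picardNumbers_four : R_4 = {1, …, 8, 10, 16}`** — the printed algorithm of §6.2 ("we compute
  `R_g` as follows: (i) […] `R_g ⊃ {1, …, 2g−1}` […] (ii) compute all possible Picard numbers of
  self-product abelian varieties `A^k`, where `dim A = g/k`; (iii) for every pair `(g_1, g_2)` […] compute
  `R_{g_1} + R_{g_2}`; (iv) assemble everything in light of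
  `R_g = ∪_{k|g} {ρ(A^k) | A simple, dim A = g/k} ∪ ∪_{1≤n≤g−1} (R_n + R_{g−n})`") RUN AT `g = 4` as a
  theorem: `{1, …, 8} ⊆ R_4` (Prop. 6.4), `10, 16 ∈ R_4`, `11, …, 15 ∉ R_4` (Thm. 1.1 (1)) are in the
  tree; the new exclusion **`nine_not_mem_picardNumbers_four : 9 ∉ R_4`** is
  `IsAbelianVariety.finrank_neronSeveriGroup_ne_nine_of_finrank_eq_four`, by the Poincaré decomposition:
  `r ≥ 3` isotypic components give `ρ ≤ M_{3,4} = 6` (Prop. 3.1); `r = 2` gives parts of dimensions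
  `{1, 3}` or `{2, 2}`; and an isotypic `Xⁿ` of dimension `m = n·dim X ≤ 4` (`X` simple) has
  `ρ(Xⁿ) = nρ(X) + C(n,2)·dim_ℚ End_ℚ(X)` (Cor. 2.5) with `1 ≤ ρ(X) ≤ dim_ℚ End_ℚ(X) ∣ 2 dim X`, whence
  `m = 1 ⇒ ρ = 1`, `m = 2 ⇒ ρ ≤ 4`, `m = 3 ⇒ ρ ≤ 6 ∨ ρ = 9`, `m = 4 ⇒ ρ ≠ 9`
  (`IsSimple.finrank_neronSeveriGroup_pow_of_mul_finrank_le_four`).  The VALUE `R_4 = {1, …, 8, 10, 16}`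
  is not printed in the held text of the source (which gives the algorithm and `R_1, R_2, R_3`); it is
  the algorithm's output, proved here.
* §F6 **`picardNumbers_five : R_5 = {1, …, 13, 15, 17, 25}`** — the same at `g = 5`: `{1, …, 10}`
  (Prop. 6.4), `11 ∈ R_4 + 1`, `12 = 3 + 9`, `13 = 4 + 9`, `15 = C(6,2)`, `17 = 4² + 1`, `25 = 5²` are in
  the tree or §F4; `18, …, 24 ∉ R_5` is Thm. 1.1 (1); the new exclusions **`14, 16 ∉ R_5`**
  (`IsAbelianVariety.finrank_neronSeveriGroup_ne_of_finrank_eq_five`) follow from the refined factor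
  analysis `m = 4 ⇒ ρ(Xⁿ) ≤ 8 ∨ ρ ∈ {10, 12, 16}`, `m = 5 ⇒ ρ(Xⁿ) ≤ 10 ∨ ρ ∈ {15, 25}`
  (`IsSimple.finrank_neronSeveriGroup_pow_of_mul_finrank_le_five`) and `M_{3,5} = 11`.

Not covered: Prop. 6.3 for `k ≥ 2` and hence Prop. 6.1 for summands `x ∈ R_g` with `x > g`
(non-isogenous deformations of simple abelian varieties with prescribed endomorphism algebra — Shimura's
moduli of PEL type); `R_6` and beyond (there the Albert type of `End_ℚ` of the simple factors
enters: e.g. `24 ∉ R_6` needs `ρ(S) ≤ 3` for simple abelian surfaces `S` with `dim_ℚ End_ℚ(S) = 4`).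

## References

* [HulekLaface2019PicardNumbersAV] K. Hulek, R. Laface, *On the Picard numbers of abelian varieties*,
  Ann. Sc. Norm. Super. Pisa (5) XIX (2019), §1 Thm. 1.1, §2.1 Cor. 2.3, §2.2 Cor. 2.5, §3.1 Prop. 3.1,
  §6.1 Props. 6.1, 6.2, 6.3, §6.2 Prop. 6.4 and the algorithm (i)–(iv).
* [Lange2023AbelianVarietiesComplex] H. Lange, *Abelian Varieties over the Complex Numbers* (2023),
  §2.4.4 Thm. 2.4.25, Cor. 2.4.26, §3.1 Prop. 3.1.1, §3.1.5 Exercise (6).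
-/

noncomputable section

open Module Matrix
open Complex (I ofReal)

namespace Literature.Geometry.Kaehler

namespace ComplexTorus

/-! ## §F1 Coefficient extraction with two constants: `𝒴_{N'} 𝒞 𝒴_N` and `𝒟 𝒴_N = 𝒴_{N'} 𝒜` -/

section PolyTwo

variable {n : ℕ} (N N' : ℤ)

/-- `coeff_d ((u + X^a) · c · (v + X^b)) = c·[d = a + b]` for `d ∉ {0, a, b}`. [folklore] -/
private theorem coeff_entry_mul_C_mul_entry₂ (c u v : ℤ) (a b d : ℕ) (hd : d ≠ 0) (hda : d ≠ a)
    (hdb : d ≠ b) :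
    ((Polynomial.C u + Polynomial.X ^ a) * Polynomial.C c * (Polynomial.C v + Polynomial.X ^ b)).coeff d =
      if d = a + b then c else 0 := by
  have h : (Polynomial.C u + Polynomial.X ^ a) * Polynomial.C c * (Polynomial.C v + Polynomial.X ^ b) =
      Polynomial.C (u * c * v) + Polynomial.C (u * c) * Polynomial.X ^ b +
        Polynomial.C (c * v) * Polynomial.X ^ a + Polynomial.C c * Polynomial.X ^ (a + b) := by
    simp only [Polynomial.C_mul, pow_add]; ring
  rw [h, Polynomial.coeff_add, Polynomial.coeff_add, Polynomial.coeff_add, Polynomial.coeff_C, if_neg hd,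
    Polynomial.coeff_C_mul_X_pow, if_neg hdb, Polynomial.coeff_C_mul_X_pow, if_neg hda,
    Polynomial.coeff_C_mul_X_pow, zero_add, zero_add, zero_add]

/-- `coeff_d ((u + X^a) · c) = c·[d = a]` for `d ≠ 0`. [folklore] -/
private theorem coeff_entry_mul_C₂ (c u : ℤ) (a d : ℕ) (hd : d ≠ 0) :
    ((Polynomial.C u + Polynomial.X ^ a) * Polynomial.C c).coeff d = if d = a then c else 0 := by
  rw [add_mul, ← Polynomial.C_mul, Polynomial.coeff_add, Polynomial.coeff_C, if_neg hd, zero_add, mul_comm,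
    Polynomial.coeff_C_mul_X_pow]

/-- Off-diagonal top coefficients of `𝒴_{N'}𝒞𝒴_N` (two constants): for `j ≠ k` the coefficient of
`X^{e(j,l₀)+e(m₀,k)}` in the entry `(j, k)` is `C_{l₀m₀}`. [cite: HulekLaface2019PicardNumbersAV, §6.1 Prop. 6.3 (explicit non-isogenous witnesses, this file)] -/
theorem coeff_picardOnePolyMatrix_mul_mul₂ (C₀ : Matrix (Fin n) (Fin n) ℤ) {j k : Fin n} (hjk : j ≠ k)
    (l₀ m₀ : Fin n) :
    ((picardOnePolyMatrix n N' * C₀.map Polynomial.C * picardOnePolyMatrix n N) j k).coeff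
        (picardOneExponent n j l₀ + picardOneExponent n m₀ k) = C₀ l₀ m₀ := by
  have hd0 : picardOneExponent n j l₀ + picardOneExponent n m₀ k ≠ 0 :=
    (Nat.add_pos_left (Nat.pos_of_ne_zero (picardOneExponent_ne_zero n j l₀)) _).ne'
  simp only [Matrix.mul_apply, Finset.sum_mul, Polynomial.finsetSum_coeff, Matrix.map_apply,
    picardOnePolyMatrix_apply]
  have hterm : ∀ m l : Fin n,
      ((Polynomial.C (if j = l then N' else 0) + Polynomial.X ^ picardOneExponent n j l) *
            Polynomial.C (C₀ l m) *
          (Polynomial.C (if m = k then N else 0) + Polynomial.X ^ picardOneExponent n m k)).coeff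
          (picardOneExponent n j l₀ + picardOneExponent n m₀ k) =
        if l₀ = l then (if m₀ = m then C₀ l m else 0) else 0 := by
    intro m l
    rw [coeff_entry_mul_C_mul_entry₂ _ _ _ _ _ _ hd0 (picardOneExponent_add_ne n _ _ _ _ _ _)
      (picardOneExponent_add_ne n _ _ _ _ _ _)]
    simp only [picardOneExponent_add_eq_add_iff_of_ne hjk, ite_and]
  simp_rw [hterm]
  simp only [Finset.sum_ite_eq, Finset.mem_univ, if_true]

/-- Diagonal top coefficients of `𝒴_{N'}𝒞𝒴_N`: the coefficient of `X^{2e(j,l₀)}` in the entry `(j, j)`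
is `C_{l₀l₀}`. [cite: HulekLaface2019PicardNumbersAV, §6.1 Prop. 6.3 (explicit non-isogenous witnesses, this file)] -/
theorem coeff_picardOnePolyMatrix_mul_mul_self₂ (C₀ : Matrix (Fin n) (Fin n) ℤ) (j l₀ : Fin n) :
    ((picardOnePolyMatrix n N' * C₀.map Polynomial.C * picardOnePolyMatrix n N) j j).coeff
        (picardOneExponent n j l₀ + picardOneExponent n l₀ j) = C₀ l₀ l₀ := by
  have hd0 : picardOneExponent n j l₀ + picardOneExponent n l₀ j ≠ 0 :=
    (Nat.add_pos_left (Nat.pos_of_ne_zero (picardOneExponent_ne_zero n j l₀)) _).ne'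
  simp only [Matrix.mul_apply, Finset.sum_mul, Polynomial.finsetSum_coeff, Matrix.map_apply,
    picardOnePolyMatrix_apply]
  have hterm : ∀ m l : Fin n,
      ((Polynomial.C (if j = l then N' else 0) + Polynomial.X ^ picardOneExponent n j l) *
            Polynomial.C (C₀ l m) *
          (Polynomial.C (if m = j then N else 0) + Polynomial.X ^ picardOneExponent n m j)).coeff
          (picardOneExponent n j l₀ + picardOneExponent n l₀ j) =
        if l₀ = l then (if l₀ = m then C₀ l m else 0) else 0 := by
    intro m l
    rw [coeff_entry_mul_C_mul_entry₂ _ _ _ _ _ _ hd0 (picardOneExponent_add_ne n _ _ _ _ _ _)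
      (picardOneExponent_add_ne n _ _ _ _ _ _)]
    simp only [eq_comm (a := picardOneExponent n j l₀ + picardOneExponent n l₀ j),
      picardOneExponent_add_eq_add_iff_self, ite_and, eq_comm (a := l) (b := l₀), eq_comm (a := m) (b := l₀)]
  simp_rw [hterm]
  simp only [Finset.sum_ite_eq, Finset.mem_univ, if_true]

/-- **`𝒜 = 𝒴_{N'}𝒞𝒴_N` with `𝒜, 𝒞` constant forces `𝒞 = 0`** (two constants, every `g`).
[cite: HulekLaface2019PicardNumbersAV, §6.1 Prop. 6.3 (explicit non-isogenous witnesses, this file)] -/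
theorem eq_zero_of_map_C_eq_picardOnePolyMatrix_mul_mul₂ {A₀ C₀ : Matrix (Fin n) (Fin n) ℤ}
    (h : A₀.map Polynomial.C = picardOnePolyMatrix n N' * C₀.map Polynomial.C * picardOnePolyMatrix n N) :
    C₀ = 0 := by
  ext l m
  by_cases hlm : l = m
  · subst hlm
    have h1 := congrArg (fun M : Matrix (Fin n) (Fin n) (Polynomial ℤ) ↦
      (M l l).coeff (picardOneExponent n l l + picardOneExponent n l l)) h
    have hd0 : picardOneExponent n l l + picardOneExponent n l l ≠ 0 :=
      (Nat.add_pos_left (Nat.pos_of_ne_zero (picardOneExponent_ne_zero n l l)) _).ne'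
    simp only [coeff_picardOnePolyMatrix_mul_mul_self₂ N N' C₀ l l, Matrix.map_apply, Polynomial.coeff_C,
      if_neg hd0] at h1
    rw [Matrix.zero_apply, ← h1]
  · have h1 := congrArg (fun M : Matrix (Fin n) (Fin n) (Polynomial ℤ) ↦
      (M l m).coeff (picardOneExponent n l l + picardOneExponent n m m)) h
    have hd0 : picardOneExponent n l l + picardOneExponent n m m ≠ 0 :=
      (Nat.add_pos_left (Nat.pos_of_ne_zero (picardOneExponent_ne_zero n l l)) _).ne'
    simp only [coeff_picardOnePolyMatrix_mul_mul₂ N N' C₀ hlm, Matrix.map_apply, Polynomial.coeff_C,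
      if_neg hd0] at h1
    rw [Matrix.zero_apply, ← h1]

/-- The coefficient of `X^{e(l₀,j)}` in the DIAGONAL entry `(𝒴_{N'}𝒜)_{jj}` is `A_{l₀j}`.
[cite: HulekLaface2019PicardNumbersAV, §6.1 Prop. 6.3 (explicit non-isogenous witnesses, this file)] -/
theorem coeff_picardOnePolyMatrix_mul_map_self (A₀ : Matrix (Fin n) (Fin n) ℤ) (j l₀ : Fin n) :
    ((picardOnePolyMatrix n N' * A₀.map Polynomial.C) j j).coeff (picardOneExponent n l₀ j) = A₀ l₀ j := by
  simp only [Matrix.mul_apply, Polynomial.finsetSum_coeff, Matrix.map_apply, picardOnePolyMatrix_apply]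
  have hterm : ∀ l : Fin n,
      ((Polynomial.C (if j = l then N' else 0) + Polynomial.X ^ picardOneExponent n j l) *
          Polynomial.C (A₀ l j)).coeff (picardOneExponent n l₀ j) = if l₀ = l then A₀ l j else 0 := by
    intro l
    rw [coeff_entry_mul_C₂ _ _ _ _ (picardOneExponent_ne_zero n l₀ j)]
    have h : picardOneExponent n l₀ j = picardOneExponent n j l ↔ l₀ = l := by
      rw [picardOneExponent_comm n j l, picardOneExponent_eq_iff_left]
    simp only [h]
  simp_rw [hterm]
  simp only [Finset.sum_ite_eq, Finset.mem_univ, if_true]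

/-- **`𝒟𝒴_N = 𝒴_{N'}𝒜` with `𝒟, 𝒜` constant**: `𝒟 = ᵗ𝒜` (diagonal entries, coefficient of `X^{e(l,j)}`),
`𝒜` is scalar (off-diagonal entries), and `N𝒟 = N'𝒜` (constant coefficients).
[cite: HulekLaface2019PicardNumbersAV, §6.1 Prop. 6.3 (explicit non-isogenous witnesses, this file)] -/
theorem transpose_eq_and_scalar_of_map_C_mul_picardOnePolyMatrix_eq₂ {D₀ A₀ : Matrix (Fin n) (Fin n) ℤ}
    (h : D₀.map Polynomial.C * picardOnePolyMatrix n N = picardOnePolyMatrix n N' * A₀.map Polynomial.C) :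
    D₀ = A₀ᵀ ∧ (∀ j l, j ≠ l → A₀ j l = 0) ∧ (∀ j k, A₀ j j = A₀ k k) ∧ ∀ j k, N * D₀ j k = N' * A₀ j k := by
  have hT : picardOnePolyMatrix n N' * A₀.map Polynomial.C =
      picardOnePolyMatrix n N' * ((A₀ᵀ).map Polynomial.C)ᵀ := by
    rw [Matrix.transpose_map, Matrix.transpose_transpose]
  -- `D = ᵗA` from the diagonal entries
  have hDA : D₀ = A₀ᵀ := by
    ext j l
    have h1 := congrArg (fun M : Matrix (Fin n) (Fin n) (Polynomial ℤ) ↦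
      (M j j).coeff (picardOneExponent n l j)) h
    simp only [coeff_map_mul_picardOnePolyMatrix, coeff_picardOnePolyMatrix_mul_map_self] at h1
    rw [Matrix.transpose_apply, ← h1]
  refine ⟨hDA, fun j l hjl ↦ ?_, fun j k ↦ ?_, fun j k ↦ ?_⟩
  · -- off-diagonal: entry `(l, j)`, coefficient of `X^{e(l, j)}`… via `D = ᵗA` and entry `(j, l)`
    have h1 := congrArg (fun M : Matrix (Fin n) (Fin n) (Polynomial ℤ) ↦
      (M l j).coeff (picardOneExponent n j j)) h
    simp only [hT, coeff_map_mul_picardOnePolyMatrix, coeff_picardOnePolyMatrix_mul_map_transpose N' A₀ᵀ (Ne.symm hjl),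
      if_neg hjl, hDA, Matrix.transpose_apply] at h1
    exact h1
  · by_cases hjk : j = k
    · rw [hjk]
    have h1 := congrArg (fun M : Matrix (Fin n) (Fin n) (Polynomial ℤ) ↦
      (M j k).coeff (picardOneExponent n j k)) h
    simp only [hT, coeff_map_mul_picardOnePolyMatrix, coeff_picardOnePolyMatrix_mul_map_transpose N' A₀ᵀ hjk,
      if_true, Matrix.transpose_apply, hDA] at h1
    exact h1
  · have h1 := congrArg (fun M : Matrix (Fin n) (Fin n) (Polynomial ℤ) ↦ (M j k).coeff 0) h
    simp only [coeff_zero_map_mul_picardOnePolyMatrix, coeff_zero_picardOnePolyMatrix_mul_map] at h1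
    exact h1

/-- **`𝒟𝒴_N = 𝒴_{N'}𝒜` with `N ≠ N'` forces `𝒜 = 0 = 𝒟`.** [cite: HulekLaface2019PicardNumbersAV, §6.1 Prop. 6.3 (explicit non-isogenous witnesses, this file)] -/
theorem eq_zero_of_map_C_mul_picardOnePolyMatrix_eq_of_ne (hNN' : N ≠ N') {D₀ A₀ : Matrix (Fin n) (Fin n) ℤ}
    (h : D₀.map Polynomial.C * picardOnePolyMatrix n N = picardOnePolyMatrix n N' * A₀.map Polynomial.C) :
    A₀ = 0 ∧ D₀ = 0 := by
  obtain ⟨hDA, hoff, hdiag, hconst⟩ := transpose_eq_and_scalar_of_map_C_mul_picardOnePolyMatrix_eq₂ N N' h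
  have hA : A₀ = 0 := by
    ext j l
    rw [Matrix.zero_apply]
    by_cases hjl : j = l
    · subst hjl
      have h1 := hconst j j
      rw [hDA, Matrix.transpose_apply] at h1
      have h2 : (N - N') * A₀ j j = 0 := by rw [sub_mul, h1, sub_self]
      exact (mul_eq_zero.1 h2).resolve_left (sub_ne_zero.2 hNN')
    · exact hoff j l hjl
  refine ⟨hA, ?_⟩
  rw [hDA, hA, Matrix.transpose_zero]

variable {N N'} {t : ℝ}

/-- Evaluation at `t` of a constant is the constant. [folklore] -/
private theorem aeval_comp_C₂ :
    ((⇑(Polynomial.aeval t : Polynomial ℤ →ₐ[ℤ] ℝ)) ∘ (⇑(Polynomial.C : ℤ →+* Polynomial ℤ))) =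
      (Int.cast : ℤ → ℝ) := by
  funext a
  rw [Function.comp_apply, Polynomial.aeval_C]
  simp

/-- **Transfer, two constants**: for `t` transcendental, integer `A, C` with `A = Y_{N'} C Y_N` vanish.
[cite: HulekLaface2019PicardNumbersAV, §6.1 Prop. 6.3 (explicit non-isogenous witnesses, this file)] -/
theorem eq_zero_and_eq_zero_of_eq_picardOneMatrix_mul_mul₂ (ht : Transcendental ℤ t)
    {A₀ C₀ : Matrix (Fin n) (Fin n) ℤ}
    (h : A₀.map (Int.cast : ℤ → ℝ) =
      picardOneMatrix n N' t * C₀.map (Int.cast : ℤ → ℝ) * picardOneMatrix n N t) :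
    C₀ = 0 ∧ A₀ = 0 := by
  have hinj := Matrix.map_injective (m := Fin n) (n := Fin n) (transcendental_iff_injective.1 ht)
  have key : A₀.map Polynomial.C =
      picardOnePolyMatrix n N' * C₀.map Polynomial.C * picardOnePolyMatrix n N := by
    apply hinj
    change (A₀.map Polynomial.C).map (Polynomial.aeval t) =
      (picardOnePolyMatrix n N' * C₀.map Polynomial.C * picardOnePolyMatrix n N).map (Polynomial.aeval t)
    rw [Matrix.map_mul, Matrix.map_mul, ← picardOneMatrix_eq_map, ← picardOneMatrix_eq_map, Matrix.map_map,
      Matrix.map_map, aeval_comp_C₂]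
    exact h
  have hC : C₀ = 0 := eq_zero_of_map_C_eq_picardOnePolyMatrix_mul_mul₂ N N' key
  refine ⟨hC, ?_⟩
  rw [hC, Matrix.map_zero _ (Int.cast_zero (R := ℝ)), Matrix.mul_zero, Matrix.zero_mul] at h
  exact Matrix.map_injective (Int.cast_injective (α := ℝ))
    (h.trans (Matrix.map_zero _ Int.cast_zero).symm)

/-- **Transfer, two constants**: for `t` transcendental and `N ≠ N'`, integer `D, A` with `DY_N = Y_{N'}A`
vanish. [cite: HulekLaface2019PicardNumbersAV, §6.1 Prop. 6.3 (explicit non-isogenous witnesses, this file)] -/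
theorem eq_zero_of_mul_picardOneMatrix_eq_of_ne (ht : Transcendental ℤ t) (hNN' : N ≠ N')
    {D₀ A₀ : Matrix (Fin n) (Fin n) ℤ}
    (h : D₀.map (Int.cast : ℤ → ℝ) * picardOneMatrix n N t =
      picardOneMatrix n N' t * A₀.map (Int.cast : ℤ → ℝ)) :
    A₀ = 0 ∧ D₀ = 0 := by
  have hinj := Matrix.map_injective (m := Fin n) (n := Fin n) (transcendental_iff_injective.1 ht)
  have key : D₀.map Polynomial.C * picardOnePolyMatrix n N = picardOnePolyMatrix n N' * A₀.map Polynomial.C := by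
    apply hinj
    change (D₀.map Polynomial.C * picardOnePolyMatrix n N).map (Polynomial.aeval t) =
      (picardOnePolyMatrix n N' * A₀.map Polynomial.C).map (Polynomial.aeval t)
    rw [Matrix.map_mul, Matrix.map_mul, ← picardOneMatrix_eq_map, ← picardOneMatrix_eq_map, Matrix.map_map,
      Matrix.map_map, aeval_comp_C₂]
    exact h
  exact eq_zero_of_map_C_mul_picardOnePolyMatrix_eq_of_ne N N' hNN' key

end PolyTwo

/-! ## §F2 `Hom(X_N, X_{N'}) = 0` for `N ≠ N'`: the witnesses are pairwise non-isogenous -/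

section NonIsogenous

variable {n : ℕ} {N N' : ℤ} {t : ℝ}

/-- `ℤ → ℚ → ℝ` casts of an integer matrix. [folklore] -/
private theorem map_intCast_map_ratCast₂ {m m' : Type*} (A : Matrix m m' ℤ) :
    (A.map (Int.cast : ℤ → ℚ)).map (Rat.cast : ℚ → ℝ) = A.map (Int.cast : ℤ → ℝ) :=
  Matrix.ext fun i j ↦ Rat.cast_intCast (A i j)

/-- **`Hom_ℚ(X_N, X_{N'}) = 0` for `N ≠ N'`**, `X_M = ℂ^g/(iY_Mℤ^g ⊕ ℤ^g)`, `Y_M = M·1 + (t^{e(a,b)})`, `t`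
transcendental: an integer `(a b; c d) ∈ Hom` has `c = −Y_{N'}bY_N` (so `b = 0 = c`) and
`dY_N = Y_{N'}a` (so `a = 0 = d` as `N ≠ N'`). [cite: HulekLaface2019PicardNumbersAV, §6.1 Prop. 6.3 ("there exist at least countably many isogeny classes of abelian varieties of dimension `g` and Picard number `k`"; here `k = 1`, explicit)] -/
theorem homRat_periodIsoOfNormalForm_picardOneMatrix_eq_bot_of_ne (ht : Transcendental ℤ t) (hNN' : N ≠ N')
    (hZ : ((I • (picardOneMatrix n N t).map ofReal).map Complex.im).det ≠ 0)
    (hZ' : ((I • (picardOneMatrix n N' t).map ofReal).map Complex.im).det ≠ 0) :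
    homRat (periodIsoOfNormalForm (I • (picardOneMatrix n N t).map ofReal) hZ)
      (periodIsoOfNormalForm (I • (picardOneMatrix n N' t).map ofReal) hZ') = ⊥ := by
  refine (Submodule.eq_bot_iff _).2 fun B hB ↦ ?_
  obtain ⟨d, hd, B₀, hB₀⟩ := exists_intMatrix_map_eq_smul B
  have hB₀mem : B₀.map (Int.cast : ℤ → ℚ) ∈
      homRat (periodIsoOfNormalForm (I • (picardOneMatrix n N t).map ofReal) hZ)
        (periodIsoOfNormalForm (I • (picardOneMatrix n N' t).map ofReal) hZ') := by
    rw [hB₀]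
    exact zsmul_mem hB d
  obtain ⟨hc, hda⟩ := (mem_homRat_periodIsoOfNormalForm_I_smul_iff _ hZ _ hZ' _).1 hB₀mem
  rw [map_intCast_map_ratCast₂] at hc hda
  have e11 : (B₀.map (Int.cast : ℤ → ℝ)).toBlocks₁₁ = B₀.toBlocks₁₁.map (Int.cast : ℤ → ℝ) := rfl
  have e12 : (B₀.map (Int.cast : ℤ → ℝ)).toBlocks₁₂ = B₀.toBlocks₁₂.map (Int.cast : ℤ → ℝ) := rfl
  have e21 : (B₀.map (Int.cast : ℤ → ℝ)).toBlocks₂₁ = B₀.toBlocks₂₁.map (Int.cast : ℤ → ℝ) := rfl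
  have e22 : (B₀.map (Int.cast : ℤ → ℝ)).toBlocks₂₂ = B₀.toBlocks₂₂.map (Int.cast : ℤ → ℝ) := rfl
  rw [e21, e12] at hc
  rw [e22, e11] at hda
  obtain ⟨hb, hc0⟩ := eq_zero_and_eq_zero_of_eq_picardOneMatrix_mul_mul₂ ht (N := N) (N' := N')
    (A₀ := -B₀.toBlocks₂₁) (C₀ := B₀.toBlocks₁₂) (by rw [Matrix.map_neg _ Int.cast_neg, hc, neg_neg])
  rw [neg_eq_zero] at hc0
  obtain ⟨ha, hd0⟩ := eq_zero_of_mul_picardOneMatrix_eq_of_ne ht hNN' hda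
  have hB₀zero : B₀ = 0 := by
    rw [← fromBlocks_toBlocks B₀, ha, hb, hc0, hd0, fromBlocks_zero]
  rw [hB₀zero, Matrix.map_zero _ (Int.cast_zero (R := ℚ))] at hB₀
  ext i j
  have hij := congrFun (congrFun hB₀ i) j
  rw [Matrix.smul_apply, zsmul_eq_mul, Matrix.zero_apply, eq_comm, mul_eq_zero] at hij
  exact hij.resolve_left (Int.cast_ne_zero.2 hd)

/-- **The witnesses `X_N`, `X_{N'}` (`N ≠ N'`) are NOT isogenous** (`g ≥ 1`).
[cite: HulekLaface2019PicardNumbersAV, §6.1 Prop. 6.3 (`k = 1`, explicit)] -/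
theorem not_isIsogenous_periodIsoOfNormalForm_picardOneMatrix_of_ne [NeZero n] (ht : Transcendental ℤ t)
    (hNN' : N ≠ N') (hZ : ((I • (picardOneMatrix n N t).map ofReal).map Complex.im).det ≠ 0)
    (hZ' : ((I • (picardOneMatrix n N' t).map ofReal).map Complex.im).det ≠ 0) :
    ¬ IsIsogenous (periodIsoOfNormalForm (I • (picardOneMatrix n N t).map ofReal) hZ)
      (periodIsoOfNormalForm (I • (picardOneMatrix n N' t).map ofReal) hZ') := by
  rintro ⟨A, hA⟩
  have hdet := ((isIsogeny_iff_det_ne_zero _ _ A).1 hA).2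
  have hmem := hA.map_intCast_mem_homRat
  rw [homRat_periodIsoOfNormalForm_picardOneMatrix_eq_bot_of_ne ht hNN' hZ hZ', Submodule.mem_bot] at hmem
  have hA0 : A = 0 :=
    Matrix.map_injective (Int.cast_injective (α := ℚ)) (hmem.trans (Matrix.map_zero _ Int.cast_zero).symm)
  exact hdet (by rw [hA0, Matrix.det_zero])

end NonIsogenous

/-! ## §F3 The witnesses `X_N` for every `N > g`: abelian, simple, Picard number one -/

section Family

variable {n : ℕ} {N : ℤ} {t : ℝ}

/-- `det (Im (iY_N)) = det Y_N ≠ 0` for `0 ≤ t ≤ 1`, `N > g` (`Y_N` is positive definite).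
[cite: HulekLaface2019PicardNumbersAV, §6.2 Prop. 6.4 (explicit witness)] -/
theorem det_map_im_I_smul_picardOneMatrix_ne_zero (ht0 : 0 ≤ t) (ht1 : t ≤ 1) (hN : (n : ℤ) < N) :
    ((I • (picardOneMatrix n N t).map ofReal).map Complex.im).det ≠ 0 := by
  rw [det_map_im_I_smul_map_ofReal]
  exact (posDef_picardOneMatrix ht0 ht1 hN).det_pos.ne'

/-- **`X_N = ℂ^g/(iY_Nℤ^g ⊕ ℤ^g)` is an abelian variety** for `0 ≤ t ≤ 1`, `N > g` (Riemann's relations: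
`Y_N = ᵗY_N ≻ 0`). [cite: HulekLaface2019PicardNumbersAV, §6.2 Prop. 6.4 (explicit witness)] [cite: Lange2023AbelianVarietiesComplex, §3.1 Prop. 3.1.1] -/
theorem isAbelianVariety_periodIsoOfNormalForm_picardOneMatrix (ht0 : 0 ≤ t) (ht1 : t ≤ 1) (hN : (n : ℤ) < N)
    (hZ : ((I • (picardOneMatrix n N t).map ofReal).map Complex.im).det ≠ 0) :
    IsAbelianVariety (periodIsoOfNormalForm (I • (picardOneMatrix n N t).map ofReal) hZ) := by
  refine isAbelianVariety_periodIsoOfNormalForm_of_posDef _ _ (fun i j ↦ ?_) ?_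
  · have h := congrFun (congrFun (picardOneMatrix_transpose n N t) j) i
    rw [transpose_apply] at h
    simp only [Matrix.smul_apply, Matrix.map_apply, h]
  · have h : (Matrix.of fun i j ↦ ((I • (picardOneMatrix n N t).map ofReal) i j).im) = picardOneMatrix n N t := by
      ext i j
      simp
    rw [h]
    exact posDef_picardOneMatrix ht0 ht1 hN

/-- **`X_N` is simple** (`t` transcendental, `0 ≤ t ≤ 1`, `N > g`): `End_ℚ(X_N) = ℚ` is a field.
[cite: Lange2023AbelianVarietiesComplex, §3.1.5 Exercise (6)(a) with §2.4.4 Cor. 2.4.20] -/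
theorem isSimple_periodIsoOfNormalForm_picardOneMatrix (ht : Transcendental ℤ t) (ht0 : 0 ≤ t) (ht1 : t ≤ 1)
    (hN : (n : ℤ) < N) (hZ : ((I • (picardOneMatrix n N t).map ofReal).map Complex.im).det ≠ 0) :
    IsSimple (periodIsoOfNormalForm (I • (picardOneMatrix n N t).map ofReal) hZ) := by
  have hN0 : N ≠ 0 := by omega
  refine (isAbelianVariety_periodIsoOfNormalForm_picardOneMatrix ht0 ht1 hN hZ).isSimple_iff_isUnit_or_eq_zero.2
    fun a ↦ ?_
  have ha : (a : Matrix (Fin n ⊕ Fin n) (Fin n ⊕ Fin n) ℚ) ∈ (⊥ : Subalgebra ℚ _) := by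
    rw [← endAlgRat_periodIsoOfNormalForm_picardOneMatrix_eq_bot ht hN0 hZ]; exact a.2
  obtain ⟨q, hq⟩ := Algebra.mem_bot.1 ha
  by_cases hq0 : q = 0
  · right
    exact Subtype.ext (by rw [← hq, hq0, map_zero]; rfl)
  · left
    refine ⟨⟨a, ⟨algebraMap ℚ _ q⁻¹, Subalgebra.algebraMap_mem _ _⟩, ?_, ?_⟩, rfl⟩ <;>
      refine Subtype.ext ?_ <;>
      simp only [Subalgebra.coe_mul, Subalgebra.coe_one, ← hq, ← map_mul, mul_inv_cancel₀ hq0,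
        inv_mul_cancel₀ hq0, map_one]

/-- **Hulek–Laface Prop. 6.3 for `k = 1`, explicit**: in every dimension `g ≥ 1` a sequence
`X_{g+1+m}`, `m ∈ ℕ`, of simple abelian varieties with `End = ℤ` and Picard number one that are PAIRWISE
NON-ISOGENOUS ("there exist at least countably many isogeny classes of abelian varieties of dimension
`g` and Picard number `k`"). [cite: HulekLaface2019PicardNumbersAV, §6.1 Prop. 6.3] -/
theorem exists_seq_pairwise_not_isIsogenous_picardNumber_one (n : ℕ) [NeZero n] :
    ∃ X : ℕ → ((Fin n ⊕ Fin n → ℝ) ≃L[ℝ] (Fin n → ℂ)),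
      (∀ m, IsAbelianVariety (X m)) ∧ (∀ m, IsSimple (X m)) ∧ (∀ m, endAlgRat (X m) = ⊥) ∧
        (∀ m, finrank ℤ (neronSeveriGroup (X m)) = 1) ∧ ∀ m m', m ≠ m' → ¬ IsIsogenous (X m) (X m') := by
  have ht : Transcendental ℤ (liouvilleNumber 3) := by
    simpa using transcendental_liouvilleNumber (m := 3) (by norm_num)
  have h0 : 0 ≤ liouvilleNumber 3 := by
    have h := LiouvilleNumber.partialSum_add_remainder (m := 3) (by norm_num) 0
    have hp : LiouvilleNumber.partialSum 3 0 = 1 / 3 := by simp [LiouvilleNumber.partialSum]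
    have hr := LiouvilleNumber.remainder_pos (m := 3) (by norm_num) 0
    linarith
  have h1 : liouvilleNumber 3 ≤ 1 := by
    have h := LiouvilleNumber.partialSum_add_remainder (m := 3) (by norm_num) 0
    have hp : LiouvilleNumber.partialSum 3 0 = 1 / 3 := by simp [LiouvilleNumber.partialSum]
    have hr := LiouvilleNumber.remainder_lt' 0 (m := 3) (by norm_num)
    norm_num [Nat.factorial] at hr
    linarith
  have hN : ∀ m : ℕ, (n : ℤ) < (n : ℤ) + 1 + m := fun m ↦ by omega
  have hZ : ∀ m : ℕ, ((I • (picardOneMatrix n ((n : ℤ) + 1 + m) (liouvilleNumber 3)).map ofReal).map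
      Complex.im).det ≠ 0 := fun m ↦ det_map_im_I_smul_picardOneMatrix_ne_zero h0 h1 (hN m)
  refine ⟨fun m ↦ periodIsoOfNormalForm _ (hZ m),
    fun m ↦ isAbelianVariety_periodIsoOfNormalForm_picardOneMatrix h0 h1 (hN m) (hZ m),
    fun m ↦ isSimple_periodIsoOfNormalForm_picardOneMatrix ht h0 h1 (hN m) (hZ m),
    fun m ↦ endAlgRat_periodIsoOfNormalForm_picardOneMatrix_eq_bot ht (by have := hN m; omega) (hZ m),
    fun m ↦ finrank_neronSeveriGroup_periodIsoOfNormalForm_picardOneMatrix ht _ (hZ m),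
    fun m m' hmm' ↦ not_isIsogenous_periodIsoOfNormalForm_picardOneMatrix_of_ne ht (by omega) (hZ m) (hZ m')⟩

end Family

/-! ## §F4 A witness orthogonal to a given abelian variety; additivity `{1, …, g} + R_h ⊆ R_{g+h}` -/

section Additivity

variable {κ : Type*} [Fintype κ] [DecidableEq κ] {H : Type*} [NormedAddCommGroup H] [NormedSpace ℂ H]

/-- **A witness of Picard number one orthogonal to a given abelian variety**: for every abelian variety
`B` and every `g ≥ 1` there is `N > g` with `Hom_ℚ(X_N, B) = 0`, `X_N = ℂ^g/(iY_Nℤ^g ⊕ ℤ^g)` (the `X_N`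
are simple and pairwise non-isogenous, and each simple factor of `B` is isogenous to at most one of them —
pigeonhole over `r(B) + 1` values of `N`). [cite: HulekLaface2019PicardNumbersAV, §6.1 Prop. 6.1 (proof: "for any `k ∈ R_g` we find countably many abelian varieties of dimension `g` and Picard number `k` in different isogeny classes") and §2.1 Cor. 2.3] -/
theorem IsAbelianVariety.exists_homRat_picardOneMatrix_eq_bot {B : (κ → ℝ) ≃L[ℝ] H} (hB : IsAbelianVariety B)
    (n : ℕ) [NeZero n] {t : ℝ} (ht : Transcendental ℤ t) (ht0 : 0 ≤ t) (ht1 : t ≤ 1) :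
    ∃ (N : ℤ) (hN : (n : ℤ) < N),
      homRat (periodIsoOfNormalForm (I • (picardOneMatrix n N t).map ofReal)
        (det_map_im_I_smul_picardOneMatrix_ne_zero ht0 ht1 hN)) B = ⊥ := by
  obtain ⟨ω, hω⟩ := hB
  obtain ⟨r, V, hV, hVc, e, hVpos, hVs, -, -, he, hiso⟩ := IsRiemannForm.exists_isIsogenous_powers_pos B hω
  haveI : ∀ ν, Nonempty (Fin (subRank (V ν))) := fun ν ↦ ⟨⟨0, hVpos ν⟩⟩
  -- the candidate witnesses `X_{n+1+s}`, `s = 0, …, r`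
  set Ns : Fin (r + 1) → ℤ := fun s ↦ (n : ℤ) + 1 + (s : ℕ) with hNs
  have hN : ∀ s, (n : ℤ) < Ns s := fun s ↦ by simp only [hNs]; omega
  have hZ : ∀ s, ((I • (picardOneMatrix n (Ns s) t).map ofReal).map Complex.im).det ≠ 0 := fun s ↦
    det_map_im_I_smul_picardOneMatrix_ne_zero ht0 ht1 (hN s)
  by_contra hne
  push Not at hne
  -- each `X_{N_s}` is isogenous to some simple factor of `B`
  have key : ∀ s : Fin (r + 1), ∃ ν : Fin r,
      IsIsogenous (periodIsoOfNormalForm (I • (picardOneMatrix n (Ns s) t).map ofReal) (hZ s))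
        (subtorusPeriod B (V ν) (hV ν) (hVc ν)) := fun s ↦ by
    by_contra hall
    push Not at hall
    apply hne (Ns s) (hN s)
    rw [← Submodule.finrank_eq_zero, IsIsogenous.finrank_homRat_eq_right _ hiso, finrank_homRat_sigmaPiPeriod_right]
    refine Finset.sum_eq_zero fun ν _ ↦ ?_
    rw [finrank_homRat_powPeriod_right,
      (isSimple_periodIsoOfNormalForm_picardOneMatrix ht ht0 ht1 (hN s) (hZ s)).homRat_eq_bot (hVs ν) (hall ν),
      finrank_bot, mul_zero]
  choose f hf using key
  obtain ⟨s, s', hss', hfs⟩ := Fintype.exists_ne_map_eq_of_card_lt f (by simp)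
  have h' : IsIsogenous (subtorusPeriod B (V (f s)) (hV (f s)) (hVc (f s)))
      (periodIsoOfNormalForm (I • (picardOneMatrix n (Ns s') t).map ofReal) (hZ s')) := by
    rw [hfs]
    exact IsIsogenous.symm _ _ (hf s')
  have hNN : Ns s ≠ Ns s' := by
    simp only [hNs]
    have := Fin.val_injective.ne hss'
    omega
  exact not_isIsogenous_periodIsoOfNormalForm_picardOneMatrix_of_ne ht hNN (hZ s) (hZ s')
    (IsIsogenous.trans _ _ _ (hf s) h')

/-- **`R_h + 1 ⊆ R_{h+g}` through a witness of Picard number one** (`g ≥ 1`): for `y ∈ R_h` realised by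
`B`, `ρ(X_N × B) = 1 + y` for a witness `X_N` of dimension `g` with `Hom(X_N, B) = 0` (Cor. 2.3).
[cite: HulekLaface2019PicardNumbersAV, §6.1 Prop. 6.1 (`R_g + R_h ⊂ R_{g+h}`; here the summand `1 ∈ R_g`)] -/
theorem one_add_mem_picardNumbers {h y : ℕ} (hy : y ∈ picardNumbers h) {g : ℕ} (hg : 1 ≤ g) :
    1 + y ∈ picardNumbers (g + h) := by
  haveI : NeZero g := ⟨by omega⟩
  have ht : Transcendental ℤ (liouvilleNumber 3) := by
    simpa using transcendental_liouvilleNumber (m := 3) (by norm_num)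
  have h0 : 0 ≤ liouvilleNumber 3 := by
    have h := LiouvilleNumber.partialSum_add_remainder (m := 3) (by norm_num) 0
    have hp : LiouvilleNumber.partialSum 3 0 = 1 / 3 := by simp [LiouvilleNumber.partialSum]
    have hr := LiouvilleNumber.remainder_pos (m := 3) (by norm_num) 0
    linarith
  have h1 : liouvilleNumber 3 ≤ 1 := by
    have h := LiouvilleNumber.partialSum_add_remainder (m := 3) (by norm_num) 0
    have hp : LiouvilleNumber.partialSum 3 0 = 1 / 3 := by simp [LiouvilleNumber.partialSum]
    have hr := LiouvilleNumber.remainder_lt' 0 (m := 3) (by norm_num)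
    norm_num [Nat.factorial] at hr
    linarith
  obtain ⟨B, hB, rfl⟩ := hy
  obtain ⟨N, hN, hHom⟩ := hB.exists_homRat_picardOneMatrix_eq_bot g ht h0 h1
  have hX := isAbelianVariety_periodIsoOfNormalForm_picardOneMatrix h0 h1 hN
    (det_map_im_I_smul_picardOneMatrix_ne_zero h0 h1 hN)
  have hmem := (hX.prod hB).mem_picardNumbers
  rwa [hB.finrank_neronSeveriGroup_prod_of_homRat_eq_bot' _ hHom,
    finrank_neronSeveriGroup_periodIsoOfNormalForm_picardOneMatrix ht _ _, Module.finrank_prod,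
    Module.finrank_fin_fun, Module.finrank_fin_fun] at hmem

/-- `R_h + j ⊆ R_{h+j}` (`j` witnesses of dimension one, i.e. `j` pairwise non-isogenous elliptic curves
without complex multiplication orthogonal to `B`). [cite: HulekLaface2019PicardNumbersAV, §6.1 Prop. 6.1] -/
theorem add_mem_picardNumbers {h y : ℕ} (hy : y ∈ picardNumbers h) (j : ℕ) : j + y ∈ picardNumbers (j + h) := by
  induction j with
  | zero => simpa using hy
  | succ j ih =>
    have h1 := one_add_mem_picardNumbers ih (g := 1) le_rfl
    rw [show 1 + (j + y) = j + 1 + y by ring, show 1 + (j + h) = j + 1 + h by ring] at h1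
    exact h1

/-- **Hulek–Laface Prop. 6.1 with the summands `{1, …, g} ⊆ R_g`: `k + R_h ⊆ R_{g+h}` for `1 ≤ k ≤ g`**
(one witness `X` of dimension `g − k + 1` and `k − 1` witnesses of dimension `1`).
[cite: HulekLaface2019PicardNumbersAV, §6.1 Prop. 6.1 (`R_g + R_h ⊂ R_{g+h}`)] -/
theorem add_mem_picardNumbers_of_le {h y k g : ℕ} (hy : y ∈ picardNumbers h) (hk : 1 ≤ k) (hkg : k ≤ g) :
    k + y ∈ picardNumbers (g + h) := by
  have h1 := one_add_mem_picardNumbers hy (g := g - k + 1) (by omega)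
  have h2 := add_mem_picardNumbers h1 (k - 1)
  rw [show k - 1 + (1 + y) = k + y by omega, show k - 1 + (g - k + 1 + h) = g + h by omega] at h2
  exact h2

/-- **`R_h + R_1 ⊆ R_{h+1}`** — Prop. 6.1 for `g = 1` in full (`R_1 = {1}`): `y ∈ R_h ⇒ y + 1 ∈ R_{h+1}`.
[cite: HulekLaface2019PicardNumbersAV, §6.1 Prop. 6.1] -/
theorem image_succ_picardNumbers_subset (h : ℕ) : (· + 1) '' picardNumbers h ⊆ picardNumbers (h + 1) := by
  rintro _ ⟨y, hy, rfl⟩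
  have h1 := add_mem_picardNumbers hy 1
  rwa [add_comm 1 y, add_comm 1 h] at h1

/-- **`{2, …, 7, 10} ⊆ R_4`** (`= R_3 + 1`, with `R_3 = {1, …, 6, 9}`). [cite: HulekLaface2019PicardNumbersAV, §6.1 Prop. 6.1 with §1 (`R_3 = {1, …, 6, 9}`)] -/
theorem subset_picardNumbers_four : (Set.Icc 2 7 ∪ {10} : Set ℕ) ⊆ picardNumbers 4 := by
  intro x hx
  have hx' : x - 1 ∈ picardNumbers 3 := by
    rw [picardNumbers_three]
    rcases hx with hx | hx
    · left; rw [Set.mem_Icc] at hx ⊢; omega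
    · right; rw [Set.mem_singleton_iff] at hx ⊢; omega
  have hx1 : 1 ≤ x := by
    rcases hx with hx | hx
    · rw [Set.mem_Icc] at hx; omega
    · rw [Set.mem_singleton_iff] at hx; omega
  have h : x - 1 + 1 ∈ picardNumbers (3 + 1) := image_succ_picardNumbers_subset 3 ⟨x - 1, hx', rfl⟩
  rwa [show x - 1 + 1 = x by omega, show (3 : ℕ) + 1 = 4 by norm_num] at h

end Additivity



/-! ## §F5 `R_4 = {1, …, 8, 10, 16}`: the printed algorithm of §6.2 at `g = 4` -/

section Four

variable {ι : Type*} [Fintype ι] {E : Type*} [NormedAddCommGroup E] [NormedSpace ℂ E]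

/-- The covering space of a complex torus is finite-dimensional over `ℂ`. [folklore] -/
private theorem finiteDimensional_complex_of_period₄ (Φ : (ι → ℝ) ≃L[ℝ] E) : FiniteDimensional ℂ E := by
  haveI : FiniteDimensional ℝ E := LinearEquiv.finiteDimensional Φ.toLinearEquiv
  exact Module.Finite.of_restrictScalars_finite ℝ ℂ E

/-- **The isotypic factors `Xⁿ` of dimension `m = n · dim X ≤ 4`** (`X` simple abelian, `n ≥ 1`; step (ii)
of the algorithm of §6.2 for `g ≤ 4`): from `ρ(Xⁿ) = nρ(X) + C(n,2) dim_ℚ End_ℚ(X)` (Cor. 2.5) and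
`1 ≤ ρ(X) ≤ dim_ℚ End_ℚ(X) ∣ 2 dim X`: `m = 1 ⇒ ρ = 1`; `m = 2 ⇒ ρ ≤ 4`; `m = 3 ⇒ ρ ≤ 6` or `ρ = 9`;
`m = 4 ⇒ ρ ≠ 9`. [cite: HulekLaface2019PicardNumbersAV, §6.2 (algorithm (i)–(iv)) with §2.2 Cor. 2.5] -/
theorem IsSimple.finrank_neronSeveriGroup_pow_of_mul_finrank_le_four [DecidableEq ι] [Nonempty ι]
    {X : (ι → ℝ) ≃L[ℝ] E} (hX : IsSimple X)
    (hA : IsAbelianVariety X) {n : ℕ} (hn : 0 < n) :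
    (n * finrank ℂ E = 1 → finrank ℤ (neronSeveriGroup (powPeriod X n)) = 1) ∧
      (n * finrank ℂ E = 2 → finrank ℤ (neronSeveriGroup (powPeriod X n)) ≤ 4) ∧
      (n * finrank ℂ E = 3 → finrank ℤ (neronSeveriGroup (powPeriod X n)) ≤ 6 ∨
        finrank ℤ (neronSeveriGroup (powPeriod X n)) = 9) ∧
      (n * finrank ℂ E = 4 → finrank ℤ (neronSeveriGroup (powPeriod X n)) ≠ 9) := by
  haveI : FiniteDimensional ℂ E := finiteDimensional_complex_of_period₄ X
  have hρn : finrank ℤ (neronSeveriGroup (powPeriod X n)) =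
      n * finrank ℤ (neronSeveriGroup X) + n.choose 2 * finrank ℚ (endAlgRat X) :=
    hA.finrank_neronSeveriGroup_pow n
  have hpe : finrank ℤ (neronSeveriGroup X) ≤ finrank ℚ (endAlgRat X) :=
    hA.finrank_neronSeveriGroup_le_finrank_endAlgRat
  have hed : finrank ℚ (endAlgRat X) ∣ 2 * finrank ℂ E := hX.finrank_endAlgRat_dvd_two_mul_finrank
  have he1 : 1 ≤ finrank ℚ (endAlgRat X) := one_le_finrank_endAlgRat X
  have hp1 : finrank ℂ E = 1 → finrank ℤ (neronSeveriGroup X) = 1 := fun h ↦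
    finrank_neronSeveriGroup_eq_one_of_finrank_eq_one X h
  have hdpos : 0 < finrank ℂ E := finrank_pos_of_nonempty X
  set p := finrank ℤ (neronSeveriGroup X) with hp
  set e := finrank ℚ (endAlgRat X) with he
  set d := finrank ℂ E with hd
  rw [hρn]
  refine ⟨fun hm ↦ ?_, fun hm ↦ ?_, fun hm ↦ ?_, fun hm ↦ ?_⟩
  · -- `m = 1`: `n = d = 1`
    have hn1 : n = 1 := by nlinarith
    subst hn1
    have hd1 : d = 1 := by omega
    simp [hp1 hd1]
  · -- `m = 2`: `(n, d) = (1, 2)` or `(2, 1)`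
    have hn2 : n ≤ 2 := by nlinarith
    interval_cases n
    · have hd2 : d = 2 := by omega
      rw [hd2] at hed
      have := Nat.le_of_dvd (by norm_num) hed
      simp only [one_mul, show Nat.choose 1 2 = 0 by decide, zero_mul, add_zero]
      omega
    · have hd1 : d = 1 := by omega
      rw [hd1] at hed
      have := Nat.le_of_dvd (by norm_num) hed
      have := hp1 hd1
      simp only [show Nat.choose 2 2 = 1 by decide, one_mul]
      omega
  · -- `m = 3`: `(n, d) = (1, 3)` or `(3, 1)`
    have hn3 : n ≤ 3 := by nlinarith
    interval_cases n
    · have hd3 : d = 3 := by omega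
      rw [hd3] at hed
      have := Nat.le_of_dvd (by norm_num) hed
      left
      simp only [one_mul, show Nat.choose 1 2 = 0 by decide, zero_mul, add_zero]
      omega
    · omega
    · have hd1 : d = 1 := by omega
      rw [hd1] at hed
      have h2 := Nat.le_of_dvd (by norm_num) hed
      have h1 := hp1 hd1
      simp only [show Nat.choose 3 2 = 3 by decide]
      interval_cases e <;> omega
  · -- `m = 4`: `(n, d) = (1, 4)`, `(2, 2)` or `(4, 1)`
    have hn4 : n ≤ 4 := by nlinarith
    interval_cases n
    · have hd4 : d = 4 := by omega
      rw [hd4] at hed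
      have := Nat.le_of_dvd (by norm_num) hed
      simp only [one_mul, show Nat.choose 1 2 = 0 by decide, zero_mul, add_zero]
      omega
    · have hd2 : d = 2 := by omega
      rw [hd2] at hed
      have h4 := Nat.le_of_dvd (by norm_num) hed
      simp only [show Nat.choose 2 2 = 1 by decide, one_mul]
      interval_cases e <;> omega
    · omega
    · have hd1 : d = 1 := by omega
      rw [hd1] at hed
      have h2 := Nat.le_of_dvd (by norm_num) hed
      simp only [show Nat.choose 4 2 = 6 by decide]
      omega

/-- **`9 ∉ R_4`: no abelian fourfold has Picard number `9`** (along a Poincaré decomposition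
`A ∼ X_1^{n_1} × ⋯ × X_r^{n_r}`: `r ≥ 3` gives `ρ ≤ M_{3,4} = 6` (Prop. 3.1); `r = 2` gives parts of
dimensions `{1, 3}` (Picard numbers `1 + ({≤ 6} ∪ {9})`) or `{2, 2}` (`≤ 4 + 4`); `r = 1` is the lemma
above with `m = 4`). [cite: HulekLaface2019PicardNumbersAV, §6.2 (algorithm (i)–(iv)), §3.1 Prop. 3.1, §2.1 Cor. 2.3] -/
theorem IsAbelianVariety.finrank_neronSeveriGroup_ne_nine_of_finrank_eq_four [DecidableEq ι] {A : (ι → ℝ) ≃L[ℝ] E}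
    (hAV : IsAbelianVariety A) (hg : finrank ℂ E = 4) : finrank ℤ (neronSeveriGroup A) ≠ 9 := by
  obtain ⟨ω, hω⟩ := hAV
  obtain ⟨r, V, hV, hVc, n, hVpos, hVs, hVab, hVV, hn, hiso⟩ := IsRiemannForm.exists_isIsogenous_powers_pos A hω
  haveI : ∀ ν, Nonempty (Fin (subRank (V ν))) := fun ν ↦ ⟨⟨0, hVpos ν⟩⟩
  set X : ∀ ν : Fin r, (Fin (subRank (V ν)) → ℝ) ≃L[ℝ] cxSpan A (V ν) :=
    fun ν ↦ subtorusPeriod A (V ν) (hV ν) (hVc ν) with hXdef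
  haveI : ∀ ν, FiniteDimensional ℂ (cxSpan A (V ν)) := fun ν ↦ finiteDimensional_complex_of_period₄ (X ν)
  -- the parts `m_ν = n_ν dim X_ν` sum to `4`, so `r ≤ 4`
  have hsum : ∑ ν, n ν * finrank ℂ (cxSpan A (V ν)) = 4 := by
    rw [← finrank_powers_eq X n, ← hiso.finrank_eq _ _, hg]
  have hm1 : ∀ ν, 1 ≤ n ν * finrank ℂ (cxSpan A (V ν)) := fun ν ↦
    Nat.mul_pos (hn ν) (finrank_pos_of_nonempty (X ν))
  have hr4 : r ≤ 4 := by
    have h := Finset.sum_le_sum fun ν (_ : ν ∈ (Finset.univ : Finset (Fin r))) ↦ hm1 ν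
    rw [Finset.sum_const, Finset.card_univ, Fintype.card_fin, smul_eq_mul, mul_one, hsum] at h
    exact h
  -- `ρ(A) = Σ ρ(X_ν^{n_ν})`
  have hρ : finrank ℤ (neronSeveriGroup A) = ∑ ν, finrank ℤ (neronSeveriGroup (powPeriod (X ν) (n ν))) := by
    rw [hiso.finrank_neronSeveriGroup_eq _ _, finrank_neronSeveriGroup_powers X n hVs hVab hVV]
  have part : ∀ ν,
      (n ν * finrank ℂ (cxSpan A (V ν)) = 1 → finrank ℤ (neronSeveriGroup (powPeriod (X ν) (n ν))) = 1) ∧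
        (n ν * finrank ℂ (cxSpan A (V ν)) = 2 → finrank ℤ (neronSeveriGroup (powPeriod (X ν) (n ν))) ≤ 4) ∧
        (n ν * finrank ℂ (cxSpan A (V ν)) = 3 → finrank ℤ (neronSeveriGroup (powPeriod (X ν) (n ν))) ≤ 6 ∨
          finrank ℤ (neronSeveriGroup (powPeriod (X ν) (n ν))) = 9) ∧
        (n ν * finrank ℂ (cxSpan A (V ν)) = 4 → finrank ℤ (neronSeveriGroup (powPeriod (X ν) (n ν))) ≠ 9) :=
    fun ν ↦ (hVs ν).finrank_neronSeveriGroup_pow_of_mul_finrank_le_four (hVab ν) (hn ν)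
  rcases (show r = 0 ∨ r = 1 ∨ r = 2 ∨ 3 ≤ r by omega) with h0 | h1 | h2 | h3
  · subst h0
    simp at hsum
  · subst h1
    rw [Fin.sum_univ_one] at hsum hρ
    rw [hρ]
    exact (part 0).2.2.2 hsum
  · subst h2
    rw [Fin.sum_univ_two] at hsum hρ
    rw [hρ]
    obtain ⟨p0a, p0b, p0c, -⟩ := part 0
    obtain ⟨p1a, p1b, p1c, -⟩ := part 1
    have h0 := hm1 0
    have h1 := hm1 1
    rcases (show n 0 * finrank ℂ (cxSpan A (V 0)) = 1 ∧ n 1 * finrank ℂ (cxSpan A (V 1)) = 3 ∨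
        n 0 * finrank ℂ (cxSpan A (V 0)) = 2 ∧ n 1 * finrank ℂ (cxSpan A (V 1)) = 2 ∨
        n 0 * finrank ℂ (cxSpan A (V 0)) = 3 ∧ n 1 * finrank ℂ (cxSpan A (V 1)) = 1 by omega) with
      ⟨ha, hb⟩ | ⟨ha, hb⟩ | ⟨ha, hb⟩
    · have := p0a ha
      rcases p1c hb with h | h <;> omega
    · have := p0b ha
      have := p1b hb
      omega
    · have := p1a hb
      rcases p0c ha with h | h <;> omega
  · have hle := hiso.finrank_neronSeveriGroup_le_of_powers X n hVs hVab hVV hn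
    rw [Fintype.card_fin, hg] at hle
    interval_cases r <;> simp at hle <;> omega

/-- **`9 ∉ R_4`.** [cite: HulekLaface2019PicardNumbersAV, §6.2 (algorithm (i)–(iv))] -/
theorem nine_not_mem_picardNumbers_four : 9 ∉ picardNumbers 4 := by
  rintro ⟨A, hA, h9⟩
  exact hA.finrank_neronSeveriGroup_ne_nine_of_finrank_eq_four (by rw [Module.finrank_fin_fun]) h9

/-- **`R_4 = {1, …, 8, 10, 16}`** — the output of the printed algorithm (§6.2) for `g = 4`:
`{1, …, 8} ⊆ R_4` (Prop. 6.4), `10 = 3² + 1` (`E³ × X_1^L`), `16 = 4²` (`E⁴`); `9 ∉ R_4` (above) and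
`11, …, 15 ∉ R_4` (Thm. 1.1 (1)). [cite: HulekLaface2019PicardNumbersAV, §6.2 (algorithm (i)–(iv)) with §6.2 Prop. 6.4 and §1 Thm. 1.1 (1)] -/
theorem picardNumbers_four : picardNumbers 4 = Set.Icc 1 8 ∪ {10, 16} := by
  ext x
  constructor
  · intro hx
    have hx16 := picardNumbers_subset_Icc (by norm_num : 1 ≤ 4) hx
    rw [Set.mem_Icc] at hx16
    have h9 : x ≠ 9 := fun h ↦ nine_not_mem_picardNumbers_four (h ▸ hx)
    have hgap : ¬ (10 < x ∧ x < 16) := fun h ↦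
      not_mem_picardNumbers_of_lt_of_lt (g := 4) le_rfl (by norm_num; exact h.1) (by norm_num; exact h.2) hx
    simp only [Set.mem_union, Set.mem_Icc, Set.mem_insert_iff, Set.mem_singleton_iff]
    omega
  · rintro (hx | hx | hx)
    · exact Icc_one_two_mul_subset_picardNumbers (g := 4) (by norm_num) (by simpa using hx)
    · subst hx
      simpa using sq_add_one_mem_picardNumbers_add (k := 1) le_rfl 3
    · rw [Set.mem_singleton_iff] at hx
      subst hx
      simpa using choose_add_sum_sq_mem_picardNumbers (S := Unit) (fun _ ↦ 4) 0

end Four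



/-! ## §F6 `R_5 = {1, …, 13, 15, 17, 25}`: the algorithm at `g = 5` -/

section Five

variable {ι : Type*} [Fintype ι] {E : Type*} [NormedAddCommGroup E] [NormedSpace ℂ E]

/-- The covering space of a complex torus is finite-dimensional over `ℂ`. [folklore] -/
private theorem finiteDimensional_complex_of_period₅ (Φ : (ι → ℝ) ≃L[ℝ] E) : FiniteDimensional ℂ E := by
  haveI : FiniteDimensional ℝ E := LinearEquiv.finiteDimensional Φ.toLinearEquiv
  exact Module.Finite.of_restrictScalars_finite ℝ ℂ E

/-- **Isotypic factors of dimension `4` and `5`, refined**: `m = 4 ⇒ ρ(Xⁿ) ≤ 8 ∨ ρ ∈ {10, 12, 16}`;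
`m = 5 ⇒ ρ(Xⁿ) ≤ 10 ∨ ρ ∈ {15, 25}` (`X` simple abelian; same inputs as for `m ≤ 4`).
[cite: HulekLaface2019PicardNumbersAV, §6.2 (algorithm (ii)) with §2.2 Cor. 2.5] -/
theorem IsSimple.finrank_neronSeveriGroup_pow_of_mul_finrank_le_five [DecidableEq ι] [Nonempty ι]
    {X : (ι → ℝ) ≃L[ℝ] E} (hX : IsSimple X) (hA : IsAbelianVariety X) {n : ℕ} (hn : 0 < n) :
    (n * finrank ℂ E = 4 → finrank ℤ (neronSeveriGroup (powPeriod X n)) ≤ 8 ∨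
        finrank ℤ (neronSeveriGroup (powPeriod X n)) = 10 ∨ finrank ℤ (neronSeveriGroup (powPeriod X n)) = 12 ∨
          finrank ℤ (neronSeveriGroup (powPeriod X n)) = 16) ∧
      (n * finrank ℂ E = 5 → finrank ℤ (neronSeveriGroup (powPeriod X n)) ≤ 10 ∨
        finrank ℤ (neronSeveriGroup (powPeriod X n)) = 15 ∨ finrank ℤ (neronSeveriGroup (powPeriod X n)) = 25) := by
  haveI : FiniteDimensional ℂ E := finiteDimensional_complex_of_period₅ X
  have hρn : finrank ℤ (neronSeveriGroup (powPeriod X n)) =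
      n * finrank ℤ (neronSeveriGroup X) + n.choose 2 * finrank ℚ (endAlgRat X) :=
    hA.finrank_neronSeveriGroup_pow n
  have hpe : finrank ℤ (neronSeveriGroup X) ≤ finrank ℚ (endAlgRat X) :=
    hA.finrank_neronSeveriGroup_le_finrank_endAlgRat
  have hed : finrank ℚ (endAlgRat X) ∣ 2 * finrank ℂ E := hX.finrank_endAlgRat_dvd_two_mul_finrank
  have he1 : 1 ≤ finrank ℚ (endAlgRat X) := one_le_finrank_endAlgRat X
  have hp1 : finrank ℂ E = 1 → finrank ℤ (neronSeveriGroup X) = 1 := fun h ↦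
    finrank_neronSeveriGroup_eq_one_of_finrank_eq_one X h
  have hdpos : 0 < finrank ℂ E := finrank_pos_of_nonempty X
  set p := finrank ℤ (neronSeveriGroup X) with hp
  set e := finrank ℚ (endAlgRat X) with he
  set d := finrank ℂ E with hd
  rw [hρn]
  refine ⟨fun hm ↦ ?_, fun hm ↦ ?_⟩
  · have hn4 : n ≤ 4 := by nlinarith
    interval_cases n
    · have hd4 : d = 4 := by omega
      rw [hd4] at hed
      have := Nat.le_of_dvd (by norm_num) hed
      simp only [one_mul, show Nat.choose 1 2 = 0 by decide, zero_mul, add_zero]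
      omega
    · have hd2 : d = 2 := by omega
      rw [hd2] at hed
      have h4 := Nat.le_of_dvd (by norm_num) hed
      simp only [show Nat.choose 2 2 = 1 by decide, one_mul]
      interval_cases e <;> omega
    · omega
    · have hd1 : d = 1 := by omega
      rw [hd1] at hed
      have h2 := Nat.le_of_dvd (by norm_num) hed
      have h1 := hp1 hd1
      simp only [show Nat.choose 4 2 = 6 by decide]
      interval_cases e <;> omega
  · have hn5 : n ≤ 5 := by nlinarith
    interval_cases n
    · have hd5 : d = 5 := by omega
      rw [hd5] at hed
      have := Nat.le_of_dvd (by norm_num) hed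
      simp only [one_mul, show Nat.choose 1 2 = 0 by decide, zero_mul, add_zero]
      omega
    · omega
    · omega
    · omega
    · have hd1 : d = 1 := by omega
      rw [hd1] at hed
      have h2 := Nat.le_of_dvd (by norm_num) hed
      have h1 := hp1 hd1
      simp only [show Nat.choose 5 2 = 10 by decide]
      interval_cases e <;> omega

/-- **`14, 16 ∉ R_5`: no abelian fivefold has Picard number `14` or `16`** (`r ≥ 3`: `ρ ≤ M_{3,5} = 11`;
`r = 2`: parts of dimensions `{1, 4}` (`1 + ([1,8] ∪ {10,12,16})`) or `{2, 3}` (`[1,4] + ([1,6] ∪ {9})`);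
`r = 1`: `ρ ≤ 10` or `ρ ∈ {15, 25}`). [cite: HulekLaface2019PicardNumbersAV, §6.2 (algorithm (i)–(iv)), §3.1 Prop. 3.1, §2.1 Cor. 2.3] -/
theorem IsAbelianVariety.finrank_neronSeveriGroup_ne_of_finrank_eq_five [DecidableEq ι] {A : (ι → ℝ) ≃L[ℝ] E}
    (hAV : IsAbelianVariety A) (hg : finrank ℂ E = 5) :
    finrank ℤ (neronSeveriGroup A) ≠ 14 ∧ finrank ℤ (neronSeveriGroup A) ≠ 16 := by
  obtain ⟨ω, hω⟩ := hAV
  obtain ⟨r, V, hV, hVc, n, hVpos, hVs, hVab, hVV, hn, hiso⟩ := IsRiemannForm.exists_isIsogenous_powers_pos A hω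
  haveI : ∀ ν, Nonempty (Fin (subRank (V ν))) := fun ν ↦ ⟨⟨0, hVpos ν⟩⟩
  set X : ∀ ν : Fin r, (Fin (subRank (V ν)) → ℝ) ≃L[ℝ] cxSpan A (V ν) :=
    fun ν ↦ subtorusPeriod A (V ν) (hV ν) (hVc ν) with hXdef
  haveI : ∀ ν, FiniteDimensional ℂ (cxSpan A (V ν)) := fun ν ↦ finiteDimensional_complex_of_period₅ (X ν)
  have hsum : ∑ ν, n ν * finrank ℂ (cxSpan A (V ν)) = 5 := by
    rw [← finrank_powers_eq X n, ← hiso.finrank_eq _ _, hg]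
  have hm1 : ∀ ν, 1 ≤ n ν * finrank ℂ (cxSpan A (V ν)) := fun ν ↦
    Nat.mul_pos (hn ν) (finrank_pos_of_nonempty (X ν))
  have hr5 : r ≤ 5 := by
    have h := Finset.sum_le_sum fun ν (_ : ν ∈ (Finset.univ : Finset (Fin r))) ↦ hm1 ν
    rw [Finset.sum_const, Finset.card_univ, Fintype.card_fin, smul_eq_mul, mul_one, hsum] at h
    exact h
  have hρ : finrank ℤ (neronSeveriGroup A) = ∑ ν, finrank ℤ (neronSeveriGroup (powPeriod (X ν) (n ν))) := by
    rw [hiso.finrank_neronSeveriGroup_eq _ _, finrank_neronSeveriGroup_powers X n hVs hVab hVV]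
  have part : ∀ ν,
      (n ν * finrank ℂ (cxSpan A (V ν)) = 1 → finrank ℤ (neronSeveriGroup (powPeriod (X ν) (n ν))) = 1) ∧
        (n ν * finrank ℂ (cxSpan A (V ν)) = 2 → finrank ℤ (neronSeveriGroup (powPeriod (X ν) (n ν))) ≤ 4) ∧
        (n ν * finrank ℂ (cxSpan A (V ν)) = 3 → finrank ℤ (neronSeveriGroup (powPeriod (X ν) (n ν))) ≤ 6 ∨
          finrank ℤ (neronSeveriGroup (powPeriod (X ν) (n ν))) = 9) ∧
        (n ν * finrank ℂ (cxSpan A (V ν)) = 4 → finrank ℤ (neronSeveriGroup (powPeriod (X ν) (n ν))) ≠ 9) :=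
    fun ν ↦ (hVs ν).finrank_neronSeveriGroup_pow_of_mul_finrank_le_four (hVab ν) (hn ν)
  have part' : ∀ ν,
      (n ν * finrank ℂ (cxSpan A (V ν)) = 4 → finrank ℤ (neronSeveriGroup (powPeriod (X ν) (n ν))) ≤ 8 ∨
          finrank ℤ (neronSeveriGroup (powPeriod (X ν) (n ν))) = 10 ∨
            finrank ℤ (neronSeveriGroup (powPeriod (X ν) (n ν))) = 12 ∨
              finrank ℤ (neronSeveriGroup (powPeriod (X ν) (n ν))) = 16) ∧
        (n ν * finrank ℂ (cxSpan A (V ν)) = 5 → finrank ℤ (neronSeveriGroup (powPeriod (X ν) (n ν))) ≤ 10 ∨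
          finrank ℤ (neronSeveriGroup (powPeriod (X ν) (n ν))) = 15 ∨
            finrank ℤ (neronSeveriGroup (powPeriod (X ν) (n ν))) = 25) :=
    fun ν ↦ (hVs ν).finrank_neronSeveriGroup_pow_of_mul_finrank_le_five (hVab ν) (hn ν)
  rcases (show r = 0 ∨ r = 1 ∨ r = 2 ∨ 3 ≤ r by omega) with h0 | h1 | h2 | h3
  · subst h0
    simp at hsum
  · subst h1
    rw [Fin.sum_univ_one] at hsum hρ
    rw [hρ]
    rcases (part' 0).2 hsum with h | h | h <;> omega
  · subst h2
    rw [Fin.sum_univ_two] at hsum hρ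
    rw [hρ]
    obtain ⟨p0a, p0b, p0c, -⟩ := part 0
    obtain ⟨p1a, p1b, p1c, -⟩ := part 1
    obtain ⟨q0, -⟩ := part' 0
    obtain ⟨q1, -⟩ := part' 1
    have h0 := hm1 0
    have h1 := hm1 1
    rcases (show n 0 * finrank ℂ (cxSpan A (V 0)) = 1 ∧ n 1 * finrank ℂ (cxSpan A (V 1)) = 4 ∨
        n 0 * finrank ℂ (cxSpan A (V 0)) = 2 ∧ n 1 * finrank ℂ (cxSpan A (V 1)) = 3 ∨
        n 0 * finrank ℂ (cxSpan A (V 0)) = 3 ∧ n 1 * finrank ℂ (cxSpan A (V 1)) = 2 ∨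
        n 0 * finrank ℂ (cxSpan A (V 0)) = 4 ∧ n 1 * finrank ℂ (cxSpan A (V 1)) = 1 by omega) with
      ⟨ha, hb⟩ | ⟨ha, hb⟩ | ⟨ha, hb⟩ | ⟨ha, hb⟩
    · have := p0a ha
      rcases q1 hb with h | h | h | h <;> omega
    · have := p0b ha
      rcases p1c hb with h | h <;> omega
    · have := p1b hb
      rcases p0c ha with h | h <;> omega
    · have := p1a hb
      rcases q0 ha with h | h | h | h <;> omega
  · have hle := hiso.finrank_neronSeveriGroup_le_of_powers X n hVs hVab hVV hn
    rw [Fintype.card_fin, hg] at hle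
    interval_cases r <;> simp at hle <;> omega

/-- **`14 ∉ R_5` and `16 ∉ R_5`.** [cite: HulekLaface2019PicardNumbersAV, §6.2 (algorithm (i)–(iv))] -/
theorem not_mem_picardNumbers_five {x : ℕ} (hx : x = 14 ∨ x = 16) : x ∉ picardNumbers 5 := by
  rintro ⟨A, hA, rfl⟩
  have h := hA.finrank_neronSeveriGroup_ne_of_finrank_eq_five (by rw [Module.finrank_fin_fun])
  rcases hx with hx | hx
  · exact h.1 hx
  · exact h.2 hx

/-- **`R_5 = {1, …, 13, 15, 17, 25}`** — the algorithm of §6.2 at `g = 5`: `{1, …, 10}` (Prop. 6.4),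
`11 = 10 + 1` (`R_4 + 1`), `12 = 3 + 9` and `13 = 4 + 9` (`E_θ² × E³`, `E'² × E³`), `15 = C(6,2)` (`E_θ⁵`),
`17 = 4² + 1`, `25 = 5²`; `14, 16 ∉ R_5` (above), `18, …, 24 ∉ R_5` (Thm. 1.1 (1)).  As for `R_4`, the value
is the algorithm's output, not printed in the held text. [cite: HulekLaface2019PicardNumbersAV, §6.2 (algorithm (i)–(iv)) with §6.2 Prop. 6.4, Remark 6.5 and §1 Thm. 1.1 (1)] -/
theorem picardNumbers_five : picardNumbers 5 = Set.Icc 1 13 ∪ {15, 17, 25} := by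
  ext x
  constructor
  · intro hx
    have hx25 := picardNumbers_subset_Icc (by norm_num : 1 ≤ 5) hx
    rw [Set.mem_Icc] at hx25
    have h14 : x ≠ 14 := fun h ↦ not_mem_picardNumbers_five (Or.inl h) hx
    have h16 : x ≠ 16 := fun h ↦ not_mem_picardNumbers_five (Or.inr h) hx
    have hgap : ¬ (17 < x ∧ x < 25) := fun h ↦
      not_mem_picardNumbers_of_lt_of_lt (g := 5) (by norm_num) (by norm_num; exact h.1) (by norm_num; exact h.2) hx
    simp only [Set.mem_union, Set.mem_Icc, Set.mem_insert_iff, Set.mem_singleton_iff]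
    omega
  · rintro (hx | hx | hx | hx)
    · rw [Set.mem_Icc] at hx
      rcases Nat.lt_or_ge x 11 with h10 | h11
      · exact Icc_one_two_mul_subset_picardNumbers (g := 5) (by norm_num) (Set.mem_Icc.2 ⟨hx.1, by omega⟩)
      · rcases (show x = 11 ∨ x = 12 ∨ x = 13 by omega) with rfl | rfl | rfl
        · have h := image_succ_picardNumbers_subset 4 ⟨10, by rw [picardNumbers_four]; simp, rfl⟩
          simpa using h
        · simpa using choose_add_sum_sq_mem_picardNumbers (S := Unit) (fun _ ↦ 3) 2
        · simpa using choose_add_sum_sq_mem_picardNumbers (S := Bool) (fun b ↦ cond b 2 3) 0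
    · subst hx
      simpa [show Nat.choose 6 2 = 15 by decide] using
        choose_add_sum_sq_mem_picardNumbers (S := Fin 0) (fun i ↦ i.elim0) 5
    · subst hx
      simpa using sq_add_one_mem_picardNumbers_add (k := 1) le_rfl 4
    · rw [Set.mem_singleton_iff] at hx
      subst hx
      simpa using choose_add_sum_sq_mem_picardNumbers (S := Unit) (fun _ ↦ 5) 0

end Five

end ComplexTorus

end Literature.Geometry.Kaehler

end
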